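import Summits.MatrixMultiplication.OmegaCensus.DicyclicExactTiling
import HarnessLib

/-!
# Tools for the last `C₂ × Q_{4m}` cell (`m = 4`): two-element sumsets, a forbidden tiling of `ℤ₂ × ℤ₄`, the projection `ℤ₈ → ℤ₄`

ω-census, family (b3).  Framing: lottery ticket; floor = certified bounds/negative ranges.

Building blocks for the planned kernel proof of `β(C₂ × Q₁₆) = 32` (seat addendum §5: at `|A| = 16` the volume
`36 = law − 4` survives the vertex arithmetic only in the shapes `(1,1|1,2|2,4)` and `(1,2|1,2|2,2)`, which are excluded by
exact-vertex periodicity, the two-set criterion, a descent to `A/⟨c₀⟩ ≅ ℤ₂ × ℤ₄` and the forbidden tiling):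

* `two_set_sum_periodic`: if `{0, e, d, d+e}` (`d, e ≠ 0`) is `c₀`-periodic (`c₀ ≠ 0 = 2c₀`), then
  `d = c₀ ∨ e = c₀ ∨ (d + d = 0 ∧ d + e = c₀)` — the sumset `{x, x+d} + {y, y+e}` translated to `0`.
* `periodic_third_of_box_singletons`: a `c₀`-periodic box `{x} + {y} + Z` has `c₀`-periodic `Z`.
* `z2z4_no_exact_tiling`: there are no `d, e, a, b ∈ ℤ₂ × ℤ₄` with `{0,d,e,d+e}` of size four and
  `ℤ₂ × ℤ₄ = {0,d,e,d+e} ⊔ (a + {0,e}) ⊔ (b + {0,d})` (`decide`; the analogue in `ℤ₈` is false: `{0,1,3,4} ⊔ {2,5} ⊔ {6,7}`).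
* `zmod8_cast4_eq_iff`: the projection `ℤ₈ → ℤ₄` identifies exactly `b` and `b + 4` (`decide`).
-/

namespace Summit.MatrixMultiplication.OmegaCensus

open Finset

section TwoSets

variable {A : Type*} [AddCommGroup A] [DecidableEq A]

/-- **Two-set criterion.** If `{0, e, d, d + e}` with `d, e ≠ 0` is `c₀`-periodic (`c₀ ≠ 0`, `2c₀ = 0`), then `d = c₀`, or
`e = c₀`, or `2d = 0` and `d + e = c₀`. [folklore] -/
theorem two_set_sum_periodic {d e c₀ : A} (hc₀ : c₀ ≠ 0) (h2c : c₀ + c₀ = 0) (hd : d ≠ 0) (he : e ≠ 0)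
    (hper : ∀ q ∈ ({0, e, d, d + e} : Finset A), q + c₀ ∈ ({0, e, d, d + e} : Finset A)) :
    d = c₀ ∨ e = c₀ ∨ (d + d = 0 ∧ d + e = c₀) := by
  have mem4 : ∀ q : A, q ∈ ({0, e, d, d + e} : Finset A) ↔ (q = 0 ∨ q = e ∨ q = d ∨ q = d + e) := fun q => by
    simp only [mem_insert, mem_singleton]
  have h0 := (mem4 _).1 (hper 0 ((mem4 _).2 (Or.inl rfl)))
  rw [zero_add] at h0
  rcases h0 with h | h | h | h
  · exact absurd h hc₀
  · exact Or.inr (Or.inl h.symm)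
  · exact Or.inl h.symm
  · -- `c₀ = d + e`: the point `d` must also have its partner in the set
    have hD := (mem4 _).1 (hper d ((mem4 _).2 (Or.inr (Or.inr (Or.inl rfl)))))
    rw [h] at hD
    rcases hD with h1 | h1 | h1 | h1
    · -- `d + (d + e) = 0`: with `2c₀ = 0` this forces `e = 0`
      exfalso; apply he
      rw [h] at h2c
      linear_combination (norm := abel1) h2c - h1
    · refine Or.inr (Or.inr ⟨?_, h.symm⟩)
      linear_combination (norm := abel1) h1
    · exfalso; apply hc₀
      rw [h]; linear_combination (norm := abel1) h1
    · exfalso; apply hd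
      linear_combination (norm := abel1) h1

/-- A `c₀`-periodic box `{x} + {y} + Z` has `c₀`-periodic third factor. [folklore] -/
theorem periodic_third_of_box_singletons {x y c₀ : A} {Z : Finset A}
    (hper : ((({x} : Finset A) ×ˢ ({y} : Finset A) ×ˢ Z).image fun p : A × A × A => p.1 + p.2.1 + p.2.2).image
      (· + c₀) = (({x} : Finset A) ×ˢ ({y} : Finset A) ×ˢ Z).image fun p : A × A × A => p.1 + p.2.1 + p.2.2) :
    Z.image (· + c₀) = Z := by
  apply eq_of_subset_of_card_le _ (by rw [card_image_of_injective _ (add_left_injective c₀)])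
  intro w hw
  obtain ⟨z, hz, rfl⟩ := mem_image.1 hw
  have hmem : x + y + z + c₀ ∈ (({x} : Finset A) ×ˢ ({y} : Finset A) ×ˢ Z).image
      fun p : A × A × A => p.1 + p.2.1 + p.2.2 := by
    rw [← hper]
    exact mem_image.2 ⟨x + y + z, mem_sumset₃.2 ⟨x, mem_singleton_self _, y, mem_singleton_self _, z, hz, rfl⟩, rfl⟩
  rw [mem_sumset₃] at hmem
  obtain ⟨a, ha, b, hb, c, hc, he⟩ := hmem
  rw [mem_singleton] at ha hb
  subst ha hb
  have : c = z + c₀ := by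
    have h' : a + b + c = a + b + (z + c₀) := by rw [he]; abel
    exact add_left_cancel h'
  rw [← this]; exact hc

end TwoSets

section Finite

set_option synthInstance.maxHeartbeats 400000 in
set_option synthInstance.maxSize 4096 in
/-- **No exact tiling `ℤ₂ × ℤ₄ = {0,d,e,d+e} ⊔ (a + {0,e}) ⊔ (b + {0,d})`** with `{0,d,e,d+e}` of size four (finite check,
`8⁴` cases). [folklore] -/
theorem z2z4_no_exact_tiling :
    ∀ d e a b : ZMod 2 × ZMod 4, d ≠ 0 → e ≠ 0 → d ≠ e → d + e ≠ 0 →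
      a ∉ ({0, d, e, d + e} : Finset (ZMod 2 × ZMod 4)) → a + e ∉ ({0, d, e, d + e} : Finset (ZMod 2 × ZMod 4)) →
      b ∉ ({0, d, e, d + e} : Finset (ZMod 2 × ZMod 4)) → b + d ∉ ({0, d, e, d + e} : Finset (ZMod 2 × ZMod 4)) →
      a ≠ b → a ≠ b + d → a + e ≠ b → a + e ≠ b + d → False := by
  decide

/-- The projection `ℤ₈ → ℤ₄` identifies `b` with `b'` exactly when `b' = b` or `b' = b + 4`. [folklore] -/
theorem zmod8_cast4_eq_iff : ∀ b b' : ZMod 8, (ZMod.castHom (show 4 ∣ 8 by norm_num) (ZMod 4) b =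
    ZMod.castHom (show 4 ∣ 8 by norm_num) (ZMod 4) b') ↔ (b' = b ∨ b' = b + 4) := by
  decide

end Finite

end Summit.MatrixMultiplication.OmegaCensus
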